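import Summits.HodgeConjecture.CorCM.QuarticCMConjugationSquare
import Summits.HodgeConjecture.CorCM.IndependentCMFieldsHodge
import Literature.AlgebraicGeometry.Pohlmann1968.NondegenerateCMTypeDivisorGenerated
import HarnessLib

/-!
# `E^a × A^b` for a CM elliptic curve `E` and a CM abelian variety `A` whose CM field `K` has COMPLEX CONJUGATION A
# SQUARE on its embeddings: the common form of the cyclic and the dihedral criteria, and the Galois octic instance

COR-CM (cell `pub-hodgecm2`, seat p2 gen 16, count-neutral claim IQD4 (4/4)); NEW as stated, hence under `Summits/`.
The two unconditional two-slot families of the tree with an imaginary quadratic first slot —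
`CorCM/ImaginaryQuadraticTimesCyclicCMHodge` (seat b23: `K` Galois over `ℚ` with CYCLIC group of order `≡ 0 (mod 4)`;
mechanism: complex conjugation is a square in `Gal(K/ℚ)`) and `CorCM/ImaginaryQuadraticTimesNonGaloisQuarticCMHodge`
(this seat: `K` quartic, NOT Galois; mechanism: complex conjugation on `Hom(K, ℂ)` is the square of a `4`-cycle in the
image of `Aut(ℂ)`) — are two instances of ONE statement about the action of `Aut(ℂ)` on `Hom(K, ℂ)` (scoped
`ringEquivCompAction`), for an ARBITRARY CM field `K` (no degree, no Galois hypothesis):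

> **(□)** some `τ ∈ Aut(ℂ)` has `τ ∘ τ ∘ s = s̄` for every embedding `s : K → ℂ`.

* §1 **`isSquare_of_comm_of_card_eq_eight`** — pure group theory: in a NONABELIAN group of order `8` every central
  involution is a square (an element `g` of order `4` exists; `⟨g⟩` has index `2`; a central `z ∉ ⟨g⟩` would make
  `G = ⟨g⟩ ∪ z⟨g⟩` abelian; so `z ∈ ⟨g⟩`, `z = g²`).
* §2 (□) for GALOIS CM fields: **`exists_ringAut_smul_smul_eq_conjugate_of_isSquare_conjGal`** — if complex
  conjugation `ρ ∈ Gal(K/ℚ)` (`conjGal`) is a square `g²`, an automorphism of `ℂ` carrying a fixed embedding `s₀` to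
  `s₀ ∘ g` satisfies (□) (all embeddings are `s₀ ∘ w`); instances: `IsCyclic` of order `≡ 0 (mod 4)`
  (`…_of_isCyclic`, b23's hypothesis) and **every Galois CM field of degree `8` with NONABELIAN Galois group**
  (`isSquare_conjGal_of_card_eq_eight`, `…_of_card_eq_eight`; quaternion or dihedral: `ρ` is central —
  `conjGal_central` — hence a square by §1).
  (The non-Galois quartic instance of (□) is `QuarticCM.exists_ringAut_smul_smul_eq_conjugate`.)
* §3 (□) with an imaginary quadratic partner `k`: **`exists_ringAut_smul_eq_conjugate_smul_eq_self_of_smul_smul`**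
  (`ρ ∘ τ ∘ τ` is complex conjugation on `Hom(k, ℂ)` and the identity on `Hom(K, ℂ)`),
  **`normalClosure_inf_normalClosure_eq_bot_of_smul_smul`** (`normalClosure ℚ k ℂ ⊓ normalClosure ℚ K ℂ = ⊥`: the
  Galois closure of `K` contains no imaginary quadratic field).
* §4 the two-slot family `(K_{i₀}, K_{i₁})` (`i₀ ≠ i₁`, `∀ j, j = i₀ ∨ j = i₁`; `[K_{i₀}:ℚ] = 2`; (□) for `K_{i₁}`):
  `slotwiseIndependent_of_quadratic_of_smul_smul`, `isNondegenerateFamily_iff_of_quadratic_of_smul_smul`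
  (⟺ `Φ_{i₁}` nondegenerate), `hodgeClassSpan_prod_eq_divisorClassesSpan_of_quadratic_of_smul_smul`,
  `not_exists_exceptional_prod_of_quadratic_of_smul_smul`, **`hodgeConjectureFor_prod_of_quadratic_of_smul_smul`** —
  `B• = D•` and the Hodge conjecture on every `E^a × A^b` (every `⨁_{j<N} A_{π j}`) for `E` a CM elliptic curve and
  `A` a realisation of a NONDEGENERATE type of `K_{i₁}`, unconditionally (for `K_{i₁}` Galois with `conjGal` a square
  this is the sharp form `hodgeConjectureFor_prod_of_quadratic_of_isSquare_conjGal` appended to b23's file; (□) needs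
  no Galois hypothesis); and the octic instance **`hodgeConjectureFor_prod_of_quadratic_of_card_eq_eight`**
  (`K_{i₁}` Galois of degree `8` with nonabelian group — a quaternion CM field has no proper CM subfield, so all its CM
  types are primitive; a dihedral octic CM field is the Galois closure of its non-Galois quartic CM subfields, and the
  types induced from them are degenerate, so there the hypothesis `IsNondegenerate (Φ i₁)` carries the weight).

Everything is PROVED; theorems only (one private lattice lemma); no definition, no named fact, no `sorry`.

## References

* [Gordon1999HodgeAVSurvey] B. B. Gordon, *A survey of the Hodge conjecture for abelian varieties*, §3 Theorem (Imai,
  Murty) with proof; 7.5; 10.10.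
* [Lang2002] S. Lang, *Algebra*, 3rd ed., I §6 (groups of order `8`), VI §1 Cor. 1.4, V §3 Thm. 3.3.
* [Shimura1998] G. Shimura, *Abelian Varieties with Complex Multiplication and Modular Functions*, §8.1 Prop. 25,
  §8.4 (2).
-/

noncomputable section

open NumberField NumberField.ComplexEmbedding IntermediateField

/-! ## §1 Group theory: a central involution of a nonabelian group of order `8` is a square -/

namespace Summit.HodgeConjecture.CorCM.ConjSquare

section Group

variable {G : Type*} [Group G]

/-- A group in which every element squares to `1` is abelian (`ab = (ab)⁻¹ = b⁻¹a⁻¹ = ba`). [cite: Lang2002, I §6] -/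
theorem mul_comm_of_forall_mul_self_eq_one (h : ∀ g : G, g * g = 1) (a b : G) : a * b = b * a := by
  have hinv : ∀ g : G, g⁻¹ = g := fun g => inv_eq_of_mul_eq_one_right (h g)
  calc a * b = (a * b)⁻¹ := (hinv (a * b)).symm
    _ = b⁻¹ * a⁻¹ := mul_inv_rev a b
    _ = b * a := by rw [hinv, hinv]

/-- **A nonabelian group of order `8` has an element of order `4`** (exponent `2` would make it abelian, an element of
order `8` would make it cyclic). [cite: Lang2002, I §6] -/
theorem exists_orderOf_eq_four [Finite G] (h8 : Nat.card G = 8) (hG : ∃ a b : G, a * b ≠ b * a) :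
    ∃ g : G, orderOf g = 4 := by
  obtain ⟨a, b, hab⟩ := hG
  by_contra hno
  push Not at hno
  have hsq : ∀ g : G, g * g = 1 := by
    intro g
    have hdvd : orderOf g ∣ 2 ^ 3 := by rw [show (2 : ℕ) ^ 3 = 8 by norm_num, ← h8]; exact orderOf_dvd_natCard g
    obtain ⟨k, hk, hk'⟩ := (Nat.dvd_prime_pow Nat.prime_two).1 hdvd
    interval_cases k
    · rw [pow_zero, orderOf_eq_one_iff] at hk'; rw [hk', mul_one]
    · rw [pow_one] at hk'; rw [← pow_two, ← hk', pow_orderOf_eq_one]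
    · exact absurd hk' (hno g)
    · exfalso
      haveI := isCyclic_of_orderOf_eq_card g (by rw [hk', h8]; norm_num)
      obtain ⟨c, hc⟩ := IsCyclic.exists_generator (α := G)
      obtain ⟨m, rfl⟩ := Subgroup.mem_zpowers_iff.1 (hc a)
      obtain ⟨n, rfl⟩ := Subgroup.mem_zpowers_iff.1 (hc b)
      exact hab (zpow_mul_comm c m n)
  exact hab (mul_comm_of_forall_mul_self_eq_one hsq a b)

/-- **In a nonabelian group of order `8` every central involution is a square.**  With `g` of order `4`, the cyclic
subgroup `⟨g⟩` has index `2`; if the central `z` were outside it, `G = ⟨g⟩ ∪ z⟨g⟩` would be abelian; so `z ∈ ⟨g⟩`,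
and an involution in `⟨g⟩ ≅ C₄` is `g²`.  (Dihedral group: `r²`; quaternion group: `−1 = i²`.) [cite: Lang2002, I §6] -/
theorem isSquare_of_comm_of_card_eq_eight [Finite G] (h8 : Nat.card G = 8) (hG : ∃ a b : G, a * b ≠ b * a) {z : G}
    (hz : ∀ g : G, g * z = z * g) (hz2 : z * z = 1) : IsSquare z := by
  obtain ⟨g, hg⟩ := exists_orderOf_eq_four h8 hG
  set H : Subgroup G := Subgroup.zpowers g with hH
  have hcardH : Nat.card H = 4 := by rw [hH, Nat.card_zpowers, hg]
  have hidx : H.index = 2 := by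
    have h := Subgroup.index_mul_card H
    rw [hcardH, h8] at h
    omega
  -- `z ∈ H`: otherwise `G = H ∪ zH` is abelian
  have hzH : z ∈ H := by
    by_contra hzH
    have hdec : ∀ x : G, ∃ h ∈ H, x = h ∨ x = z * h := fun x => by
      by_cases hx : x ∈ H
      · exact ⟨x, hx, Or.inl rfl⟩
      · refine ⟨z * x, (Subgroup.mul_mem_iff_of_index_two hidx).2 (iff_of_false hzH hx), Or.inr ?_⟩
        rw [← mul_assoc, hz2, one_mul]
    have hcommH : ∀ h₁ ∈ H, ∀ h₂ ∈ H, Commute h₁ h₂ := fun h₁ hh₁ h₂ hh₂ => by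
      obtain ⟨m, rfl⟩ := Subgroup.mem_zpowers_iff.1 hh₁
      obtain ⟨n, rfl⟩ := Subgroup.mem_zpowers_iff.1 hh₂
      exact zpow_mul_comm g m n
    have hcz : ∀ w : G, Commute z w := fun w => (hz w).symm
    obtain ⟨a, b, hab⟩ := hG
    obtain ⟨h₁, hh₁, ha⟩ := hdec a
    obtain ⟨h₂, hh₂, hb⟩ := hdec b
    have hc : Commute a b := by
      rcases ha with rfl | rfl <;> rcases hb with rfl | rfl
      · exact hcommH _ hh₁ _ hh₂
      · exact ((hcz _).symm).mul_right (hcommH _ hh₁ _ hh₂)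
      · exact (hcz _).mul_left (hcommH _ hh₁ _ hh₂)
      · exact (hcz _).mul_left (((hcz _).symm).mul_right (hcommH _ hh₁ _ hh₂))
    exact hab hc
  -- an involution of `⟨g⟩`, `g` of order `4`, is `g²`
  obtain ⟨k, hk⟩ := Subgroup.mem_zpowers_iff.1 hzH
  have h2k : g ^ (2 * k) = 1 := by rw [two_mul, zpow_add, hk, hz2]
  have hdvd : (4 : ℤ) ∣ 2 * k := by
    have h := orderOf_dvd_iff_zpow_eq_one.2 h2k
    rwa [hg] at h
  have h2 : (2 : ℤ) ∣ k := by
    have h' : (2 : ℤ) * 2 ∣ 2 * k := by simpa [show (4 : ℤ) = 2 * 2 by norm_num] using hdvd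
    exact (mul_dvd_mul_iff_left two_ne_zero).1 h'
  obtain ⟨j, rfl⟩ := h2
  exact ⟨g ^ j, by rw [← hk, ← zpow_add, two_mul]⟩

end Group

/-! ## §2 Galois CM fields: (□) from a square root of complex conjugation in `Gal(K/ℚ)` -/

section Galois

open Literature.NumberTheory.ComplexMultiplication
open Literature.AlgebraicGeometry.Pohlmann1968
open Summit.HodgeConjecture.CorCM.CyclicSextic (conjugate_eq_comp_conjGal orderOf_conjGal)

variable {K : Type} [Field K] [NumberField K] [IsCMField K]

omit [IsCMField K] in
/-- For `K/ℚ` Galois every complex embedding is `s₀ ∘ w`, `w ∈ Gal(K/ℚ)` (`w ↦ s₀ ∘ w` is injective between two sets of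
`[K:ℚ]` elements); cf. `QuarticCM.exists_eq_comp_algEquiv` in `CorCM/QuarticCMTypeSlice` (same statement, heavier
imports). [folklore] -/
theorem exists_eq_comp_algEquiv_of_isGalois [IsGalois ℚ K] (s₀ s : K →+* ℂ) :
    ∃ w : K ≃ₐ[ℚ] K, s = s₀.comp w.toRingEquiv.toRingHom := by
  classical
  have hinj : Function.Injective fun w : K ≃ₐ[ℚ] K => s₀.comp w.toRingEquiv.toRingHom := fun _ _ h =>
    AlgEquiv.ext fun x => s₀.injective (RingHom.congr_fun h x)
  have hbij : Function.Bijective fun w : K ≃ₐ[ℚ] K => s₀.comp w.toRingEquiv.toRingHom := by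
    rw [Fintype.bijective_iff_injective_and_card]
    refine ⟨hinj, ?_⟩
    rw [← Nat.card_eq_fintype_card, IsGalois.card_aut_eq_finrank, Embeddings.card]
  obtain ⟨w, hw⟩ := hbij.2 s
  exact ⟨w, hw.symm⟩

/-- **(□) for a Galois CM field whose complex conjugation is a square in `Gal(K/ℚ)`**: if `ρ = g²` (`ρ = conjGal`), an
automorphism `τ` of `ℂ` with `τ ∘ s₀ = s₀ ∘ g` (transitivity of `Aut(ℂ)` on `Hom(K, ℂ)`) has `τ ∘ τ ∘ s = s̄` for every
`s = s₀ ∘ w`. [cite: Shimura1998, §8.1 Prop. 25] [cite: Lang2002, VI §1 Cor. 1.4] -/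
theorem exists_ringAut_smul_smul_eq_conjugate_of_isSquare_conjGal [IsGalois ℚ K]
    (hsq : IsSquare (conjGal : K ≃ₐ[ℚ] K)) : ∃ τ : ℂ ≃+* ℂ, ∀ s : K →+* ℂ, τ • τ • s = conjugate s := by
  obtain ⟨g, hg⟩ := hsq
  obtain ⟨s₀⟩ : Nonempty (K →+* ℂ) := inferInstance
  haveI := isPretransitive_ringEquiv_complex (K := K)
  obtain ⟨τ, hτ⟩ := MulAction.exists_smul_eq (ℂ ≃+* ℂ) s₀ (s₀.comp g.toRingEquiv.toRingHom)
  have hcomp : ∀ (w : K ≃ₐ[ℚ] K), τ • s₀.comp w.toRingEquiv.toRingHom =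
      (s₀.comp g.toRingEquiv.toRingHom).comp w.toRingEquiv.toRingHom := fun w => by
    rw [← hτ]; rfl
  refine ⟨τ, fun s => ?_⟩
  obtain ⟨w, rfl⟩ := exists_eq_comp_algEquiv_of_isGalois s₀ s
  have e1 : τ • s₀.comp w.toRingEquiv.toRingHom = s₀.comp (g * w).toRingEquiv.toRingHom := by
    rw [hcomp]; exact RingHom.ext fun _ => rfl
  have e2 : τ • s₀.comp (g * w).toRingEquiv.toRingHom = s₀.comp (g * (g * w)).toRingEquiv.toRingHom := by
    rw [hcomp]; exact RingHom.ext fun _ => rfl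
  rw [e1, e2, ← mul_assoc, ← hg, conjugate_eq_comp_conjGal, conjGal_central w]
  exact RingHom.ext fun _ => rfl

/-- **(□) for a Galois CM field with CYCLIC group of order `≡ 0 (mod 4)`** (complex conjugation is an involution of a
cyclic group of order `4m`, hence a square — b23's `isSquare_of_mul_self_eq_one_of_isCyclic`). [cite: Lang2002, VI §1 Cor. 1.4] -/
theorem exists_ringAut_smul_smul_eq_conjugate_of_isCyclic [IsGalois ℚ K] [IsCyclic (K ≃ₐ[ℚ] K)]
    (h4 : 4 ∣ Module.finrank ℚ K) : ∃ τ : ℂ ≃+* ℂ, ∀ s : K →+* ℂ, τ • τ • s = conjugate s :=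
  exists_ringAut_smul_smul_eq_conjugate_of_isSquare_conjGal
    (isSquare_of_mul_self_eq_one_of_isCyclic (by rwa [IsGalois.card_aut_eq_finrank]) conjGal_mul_conjGal)

/-- **In a Galois CM field of degree `8` with NONABELIAN Galois group (quaternion or dihedral), complex conjugation
is a square in the Galois group**: it is central (`conjGal_central`) of order `2`, and §1 applies — so the sharp form
`hodgeConjectureFor_prod_of_quadratic_of_isSquare_conjGal` of `CorCM/ImaginaryQuadraticTimesCyclicCMHodge` (seat b23)
covers these fields. [cite: Lang2002, I §6] [cite: Shimura1998, §8.1 Prop. 25] -/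
theorem isSquare_conjGal_of_card_eq_eight [IsGalois ℚ K] (h8 : Module.finrank ℚ K = 8)
    (hG : ∃ a b : K ≃ₐ[ℚ] K, a * b ≠ b * a) : IsSquare (conjGal : K ≃ₐ[ℚ] K) :=
  isSquare_of_comm_of_card_eq_eight (by rw [IsGalois.card_aut_eq_finrank, h8]) hG
    (fun w => (conjGal_central w).symm) conjGal_mul_conjGal

/-- **(□) for a Galois CM field of degree `8` with NONABELIAN Galois group** (quaternion or dihedral).
[cite: Lang2002, I §6] [cite: Shimura1998, §8.1 Prop. 25] -/
theorem exists_ringAut_smul_smul_eq_conjugate_of_card_eq_eight [IsGalois ℚ K] (h8 : Module.finrank ℚ K = 8)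
    (hG : ∃ a b : K ≃ₐ[ℚ] K, a * b ≠ b * a) : ∃ τ : ℂ ≃+* ℂ, ∀ s : K →+* ℂ, τ • τ • s = conjugate s :=
  exists_ringAut_smul_smul_eq_conjugate_of_isSquare_conjGal (isSquare_conjGal_of_card_eq_eight h8 hG)

end Galois

/-! ## §3 (□) with an imaginary quadratic partner -/

section Partner

open Literature.NumberTheory.ComplexMultiplication
open Literature.AlgebraicGeometry.Pohlmann1968
open Summit.HodgeConjecture.CorCM.QuarticCM

variable {k : Type} [Field k] [NumberField k] [IsCMField k]
variable {K : Type} [Field K] [NumberField K] [IsCMField K]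

omit [NumberField K] [IsCMField K] in
/-- **(□) ⟹ an automorphism of `ℂ` that is complex conjugation on `Hom(k, ℂ)` and the identity on `Hom(K, ℂ)`**
(namely `ρ ∘ τ ∘ τ`: `τ ∘ τ` acts trivially on the two embeddings of the imaginary quadratic `k`).
[cite: Gordon1999HodgeAVSurvey, §3 Theorem (proof)] -/
theorem exists_ringAut_smul_eq_conjugate_smul_eq_self_of_smul_smul (h2 : Module.finrank ℚ k = 2) {τ : ℂ ≃+* ℂ}
    (hτ : ∀ s : K →+* ℂ, τ • τ • s = conjugate s) :
    ∃ τ₁ : ℂ ≃+* ℂ, (∀ t : k →+* ℂ, τ₁ • t = conjugate t) ∧ ∀ s : K →+* ℂ, τ₁ • s = s := by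
  refine ⟨starRingAut * (τ * τ), fun t => ?_, fun s => ?_⟩
  · rw [mul_smul, mul_smul, smul_smul_eq_self_of_finrank_eq_two h2, conj_smul_eq_conjugate]
  · rw [mul_smul, mul_smul, hτ, conj_smul_eq_conjugate, involutive_conjugate K s]

omit [IsCMField K] in
/-- **(□) ⟹ the Galois closures of `k` and `K` in `ℂ` meet in `ℚ`** (`K` contains — indeed its Galois closure
contains — no imaginary quadratic field): the automorphism above fixes `normalClosure ℚ K ℂ` pointwise and is complex
conjugation on the quadratic `normalClosure ℚ k ℂ`, so a nonzero intersection would make `k` real.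
[cite: Lang2002, VI §1 Cor. 1.4] -/
theorem normalClosure_inf_normalClosure_eq_bot_of_smul_smul (h2 : Module.finrank ℚ k = 2) {τ : ℂ ≃+* ℂ}
    (hτ : ∀ s : K →+* ℂ, τ • τ • s = conjugate s) : normalClosure ℚ k ℂ ⊓ normalClosure ℚ K ℂ = ⊥ := by
  obtain ⟨τ₁, hτk, hτK⟩ := exists_ringAut_smul_eq_conjugate_smul_eq_self_of_smul_smul h2 hτ
  haveI : Algebra.IsQuadraticExtension ℚ k := { finrank_eq_two' := h2 }
  by_contra hne
  have hfin : Module.finrank ℚ (normalClosure ℚ k ℂ) = 2 := by rw [finrank_normalClosure_of_normal, h2]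
  haveI : FiniteDimensional ℚ (normalClosure ℚ k ℂ) := Module.finite_of_finrank_pos (by rw [hfin]; norm_num)
  have hdvd : Module.finrank ℚ ↥(normalClosure ℚ k ℂ ⊓ normalClosure ℚ K ℂ) ∣ 2 :=
    hfin ▸ finrank_dvd_of_le_right (inf_le_left : normalClosure ℚ k ℂ ⊓ normalClosure ℚ K ℂ ≤ _)
  have h1 : Module.finrank ℚ ↥(normalClosure ℚ k ℂ ⊓ normalClosure ℚ K ℂ) ≠ 1 := fun h =>
    hne (finrank_eq_one_iff.1 h)
  have h2' : Module.finrank ℚ ↥(normalClosure ℚ k ℂ ⊓ normalClosure ℚ K ℂ) = 2 := by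
    rcases (Nat.dvd_prime Nat.prime_two).1 hdvd with h | h
    · exact absurd h h1
    · exact h
  have hle : normalClosure ℚ k ℂ ≤ normalClosure ℚ K ℂ :=
    inf_eq_left.1 (eq_of_le_of_finrank_eq inf_le_left (by rw [h2', hfin]))
  obtain ⟨t⟩ : Nonempty (k →+* ℂ) := inferInstance
  have hreal : ComplexEmbedding.IsReal t := by
    rw [ComplexEmbedding.isReal_iff]
    refine RingHom.ext fun z => ?_
    have hz : t z ∈ normalClosure ℚ k ℂ := apply_mem_normalClosure (I := Unit) (K := fun _ => k) () t z
    rw [conjugate_coe_eq, ← apply_eq_conj_of_mem_normalClosure hτk hz,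
      apply_eq_self_of_mem_normalClosure hτK (hle hz)]
  exact IsTotallyComplex.complexEmbedding_not_isReal t hreal

end Partner

end Summit.HodgeConjecture.CorCM.ConjSquare

/-! ## §4 The two-slot family `(k, K)` under (□) -/

namespace Summit.HodgeConjecture.CorCM

open CategoryTheory CategoryTheory.Limits
open Literature.NumberTheory.ComplexMultiplication
open Literature.AlgebraicGeometry.Motives (AbelianVariety CMType)
open Literature.AlgebraicGeometry.HodgeTheory
open Literature.AlgebraicGeometry.ComplexMultiplication (IsCMTypeRealisation)
open Literature.AlgebraicGeometry.VanGeemen1994 (hodgeClassSpan)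
open Literature.AlgebraicGeometry.Pohlmann1968
open Literature.Barriers.HodgeConjecture (divisorClassesSpan)

/-- In a two-element index type `{i₀, i₁}`, the supremum over the indices `≠ i₀` is the value at `i₁`. [folklore] -/
private theorem iSup_subtype_ne_eq'' {I : Type} {α : Type*} [CompleteLattice α] {i₀ i₁ : I} (h01 : i₀ ≠ i₁)
    (hI : ∀ j, j = i₀ ∨ j = i₁) (f : I → α) : (⨆ j : {j : I // j ≠ i₀}, f j.1) = f i₁ := by
  apply le_antisymm
  · refine iSup_le fun j => ?_
    obtain ⟨j, hj⟩ := j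
    rcases hI j with rfl | rfl
    · exact absurd rfl hj
    · exact le_rfl
  · exact le_iSup (fun j : {j : I // j ≠ i₀} => f j.1) ⟨i₁, fun h => h01 h.symm⟩

section TwoSlots

variable {I : Type} {K : I → Type} [∀ i, Field (K i)] [∀ i, NumberField (K i)] [∀ i, IsCMField (K i)] [Fintype I]
  [Nonempty I]

omit [Fintype I] [Nonempty I] in
/-- **Galois form** under (□) for `K_{i₁}`: `L_i ∩ ∏_{j ≠ i} L_j = ℚ` slot by slot — the hypothesis of
`LinearlyDisjointCMFieldsHodge.hodgeConjectureFor_prod_of_normalClosure_inf_eq_bot`. [cite: Lang2002, VI §1 Cor. 1.4] -/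
theorem normalClosure_inf_iSup_eq_bot_of_quadratic_of_smul_smul {i₀ i₁ : I} (h01 : i₀ ≠ i₁)
    (hI : ∀ j, j = i₀ ∨ j = i₁) (h0 : Module.finrank ℚ (K i₀) = 2) {τ : ℂ ≃+* ℂ}
    (hτ : ∀ s : K i₁ →+* ℂ, τ • τ • s = conjugate s) (i : I) :
    normalClosure ℚ (K i) ℂ ⊓ (⨆ j : {j : I // j ≠ i}, normalClosure ℚ (K j.1) ℂ) = ⊥ := by
  rcases hI i with rfl | rfl
  · rw [iSup_subtype_ne_eq'' h01 hI (fun j => normalClosure ℚ (K j) ℂ)]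
    exact ConjSquare.normalClosure_inf_normalClosure_eq_bot_of_smul_smul h0 hτ
  · rw [iSup_subtype_ne_eq'' (Ne.symm h01) (fun j => (hI j).symm) (fun j => normalClosure ℚ (K j) ℂ), inf_comm]
    exact ConjSquare.normalClosure_inf_normalClosure_eq_bot_of_smul_smul h0 hτ

omit [Fintype I] [Nonempty I] in
/-- **Slotwise independence under (□).** [cite: Gordon1999HodgeAVSurvey, §3 Theorem (proof)] -/
theorem slotwiseIndependent_of_quadratic_of_smul_smul {i₀ i₁ : I} (hI : ∀ j, j = i₀ ∨ j = i₁)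
    (h0 : Module.finrank ℚ (K i₀) = 2) {τ : ℂ ≃+* ℂ} (hτ : ∀ s : K i₁ →+* ℂ, τ • τ • s = conjugate s) :
    SlotwiseIndependent (ℂ ≃+* ℂ) fun i => K i →+* ℂ := by
  obtain ⟨τ₁, h₁, h₁'⟩ := ConjSquare.exists_ringAut_smul_eq_conjugate_smul_eq_self_of_smul_smul h0 hτ
  refine QuarticCM.slotwiseIndependent_of_two_slots (E := fun i => K i →+* ℂ) hI (starRingAut : ℂ ≃+* ℂ) τ₁
    (fun g => ?_) (fun s => ?_) (fun s => ?_) h₁'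
  · rcases QuarticCM.smul_eq_self_or_eq_conjugate_of_finrank_eq_two h0 g with h | h
    · exact Or.inl h
    · exact Or.inr fun s => by rw [h, conj_smul_eq_conjugate]
  · change (starRingAut : ℂ ≃+* ℂ) • (starRingAut : ℂ ≃+* ℂ) • s = s
    rw [conj_smul_eq_conjugate, conj_smul_eq_conjugate, ComplexEmbedding.involutive_conjugate (K i₀) s]
  · change τ₁ • s = (starRingAut : ℂ ≃+* ℂ) • s
    rw [h₁, conj_smul_eq_conjugate]

/-- **Nondegenerate family ⟺ nondegenerate second slot** under (□). [cite: Gordon1999HodgeAVSurvey, §3 Theorem and 7.5] -/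
theorem isNondegenerateFamily_iff_of_quadratic_of_smul_smul {i₀ i₁ : I} (hI : ∀ j, j = i₀ ∨ j = i₁)
    (h0 : Module.finrank ℚ (K i₀) = 2) {τ : ℂ ≃+* ℂ} (hτ : ∀ s : K i₁ →+* ℂ, τ • τ • s = conjugate s)
    (Φ : ∀ i, CMType (K i)) : CMAlgebra.IsNondegenerateFamily Φ ↔ IsNondegenerate (Φ i₁) := by
  rw [isNondegenerateFamily_iff_forall_isNondegenerate (slotwiseIndependent_of_quadratic_of_smul_smul hI h0 hτ) Φ]
  refine ⟨fun h => h i₁, fun h i => ?_⟩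
  rcases hI i with rfl | rfl
  · exact isNondegenerate_of_finrank_eq_two (Φ _) h0
  · exact h

variable {Φ : ∀ i, CMType (K i)}
variable {A : I → AbelianVariety ℂ} {ι : ∀ i, 𝓞 (K i) →+* End (A i)}
  {θ : ∀ i, K i →+* Module.End ℂ (complexBetti (A i).X 1)}

/-- **`Bᵐ ⊗ ℂ = Dᵐ ⊗ ℂ` on every `E^a × A^b`** under (□), `A` a realisation of a nondegenerate type of `K_{i₁}`.
[cite: Gordon1999HodgeAVSurvey, §3 Theorem (2) and 7.5] -/
theorem hodgeClassSpan_prod_eq_divisorClassesSpan_of_quadratic_of_smul_smul {i₀ i₁ : I}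
    (hI : ∀ j, j = i₀ ∨ j = i₁) (h0 : Module.finrank ℚ (K i₀) = 2) {τ : ℂ ≃+* ℂ}
    (hτ : ∀ s : K i₁ →+* ℂ, τ • τ • s = conjugate s) (hΦ : IsNondegenerate (Φ i₁))
    (hA : ∀ i, IsCMTypeRealisation (Φ i) (A i) (ι i) (θ i)) {N : ℕ} (π : Fin N → I) (m : ℕ) :
    hodgeClassSpan (⨁ fun j : Fin N => A (π j)).dim (⨁ fun j : Fin N => A (π j)).X m =
      divisorClassesSpan (⨁ fun j : Fin N => A (π j)).X (⨁ fun j : Fin N => A (π j)).dim m :=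
  ((isNondegenerateFamily_iff_of_quadratic_of_smul_smul hI h0 hτ Φ).2 hΦ).hodgeClassSpan_prod_eq_divisorClassesSpan
    hA π m

/-- **No `E^a × A^b` under (□) supports an exotic Hodge class.** [cite: Gordon1999HodgeAVSurvey, §3 Theorem (2) and 7.5] -/
theorem not_exists_exceptional_prod_of_quadratic_of_smul_smul {i₀ i₁ : I} (hI : ∀ j, j = i₀ ∨ j = i₁)
    (h0 : Module.finrank ℚ (K i₀) = 2) {τ : ℂ ≃+* ℂ} (hτ : ∀ s : K i₁ →+* ℂ, τ • τ • s = conjugate s)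
    (hΦ : IsNondegenerate (Φ i₁)) (hA : ∀ i, IsCMTypeRealisation (Φ i) (A i) (ι i) (θ i)) {N : ℕ}
    (π : Fin N → I) (m : ℕ) :
    ¬∃ c : complexBetti (⨁ fun j : Fin N => A (π j)).X (2 * m), IsRationalClass c ∧
        IsOfHodgeType (⨁ fun j : Fin N => A (π j)).dim (⨁ fun j : Fin N => A (π j)).X (2 * m) m m c ∧
        c ∉ divisorClassesSpan (⨁ fun j : Fin N => A (π j)).X (⨁ fun j : Fin N => A (π j)).dim m :=
  ((isNondegenerateFamily_iff_of_quadratic_of_smul_smul hI h0 hτ Φ).2 hΦ).not_exists_exceptional_prod hA π m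

/-- **The Hodge conjecture for every `E^a × A^b` under (□)**: `E` a CM elliptic curve (any imaginary quadratic field
`K_{i₀}`), `A` a realisation of a NONDEGENERATE CM type of a CM field `K_{i₁}` on whose embeddings complex conjugation
is the square of an automorphism of `ℂ` — UNCONDITIONAL, no named fact; common generalisation of
`hodgeConjectureFor_prod_of_quadratic_of_cyclic` (b23) and `hodgeConjectureFor_prod_of_quadratic_of_not_isGalois`.
[cite: Gordon1999HodgeAVSurvey, §3 Theorem and 10.10] -/
theorem hodgeConjectureFor_prod_of_quadratic_of_smul_smul {i₀ i₁ : I} (hI : ∀ j, j = i₀ ∨ j = i₁)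
    (h0 : Module.finrank ℚ (K i₀) = 2) {τ : ℂ ≃+* ℂ} (hτ : ∀ s : K i₁ →+* ℂ, τ • τ • s = conjugate s)
    (hΦ : IsNondegenerate (Φ i₁)) (hA : ∀ i, IsCMTypeRealisation (Φ i) (A i) (ι i) (θ i)) {N : ℕ}
    (π : Fin N → I) : HodgeConjectureFor (⨁ fun j : Fin N => A (π j)).dim (⨁ fun j : Fin N => A (π j)).X :=
  ((isNondegenerateFamily_iff_of_quadratic_of_smul_smul hI h0 hτ Φ).2 hΦ).hodgeConjectureFor_prod hA π

/-- **Octic instance: the Hodge conjecture for every `E^a × A^b` with `A` a realisation of a nondegenerate CM type of a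
GALOIS CM field of degree `8` with NONABELIAN Galois group** (quaternion or dihedral octic CM fields), `E` any CM
elliptic curve; unconditional.
[cite: Gordon1999HodgeAVSurvey, §3 Theorem and 10.10] [cite: Lang2002, I §6] -/
theorem hodgeConjectureFor_prod_of_quadratic_of_card_eq_eight {i₀ i₁ : I} (hI : ∀ j, j = i₀ ∨ j = i₁)
    (h0 : Module.finrank ℚ (K i₀) = 2) [IsGalois ℚ (K i₁)] (h8 : Module.finrank ℚ (K i₁) = 8)
    (hG : ∃ a b : K i₁ ≃ₐ[ℚ] K i₁, a * b ≠ b * a) (hΦ : IsNondegenerate (Φ i₁))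
    (hA : ∀ i, IsCMTypeRealisation (Φ i) (A i) (ι i) (θ i)) {N : ℕ} (π : Fin N → I) :
    HodgeConjectureFor (⨁ fun j : Fin N => A (π j)).dim (⨁ fun j : Fin N => A (π j)).X := by
  obtain ⟨τ, hτ⟩ := ConjSquare.exists_ringAut_smul_smul_eq_conjugate_of_card_eq_eight h8 hG
  exact hodgeConjectureFor_prod_of_quadratic_of_smul_smul hI h0 hτ hΦ hA π

end TwoSlots

end Summit.HodgeConjecture.CorCM

end
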